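import Summits.Ventures.PercRepro.C041BlockMapBundle
import Summits.Ventures.PercRepro.C041BlockMapHang
import Summits.Ventures.PercRepro.C041BlockMapTransport

/-!
# ROW C-041 — THEOREM (SURGERY CLOSURE): the cone hosts are closed under the surgeries of the block map, packaged
as one inductive closure (p6, gen 35; the corollaries `inCone_blockMap_*` of `C041BlockMapSubdiv`,
`C041BlockMapReductions`, `C041BlockMapParallel`, `C041BlockMapWedge`, `C041BlockMapHang`,
`C041BlockMapTransport`, `C041BlockMapPath` and `C041BlockMapBundle` under one theorem name)

A host `Z` with exits `u` and anchor `a` is a CONE HOST (`ConeHost Z u a`) when its block map sends every family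
of cone members into the cone — CONJECTURE (BLOCK MAP) for that host.  The BUILT hosts (`Built Z u a`, an
inductive predicate over hosts of arbitrary vertex / edge types) are the closure of the cone hosts under the
surgeries: subdivision of an edge (with the loopified host), replacement of an edge by a path with `n` internal
vertices, a loop at a vertex, a pendant edge to a new vertex, loopification of a deleted edge, doubling of an edge
(with the contracted host), replacement of an edge by a bundle of parallel copies, the wedge of two hosts at
their anchors, the hanging of a host at a cut vertex, the re-indexing of the exits and the isomorphisms of
hosts.  **THEOREM (SURGERY CLOSURE)** (`coneHost_of_built`): every built host is a cone host.  Read with the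
reductions of the companion modules: CONJECTURE (BLOCK MAP) for every host follows from its truth on the simple
2-connected hosts with every non-terminal vertex of degree `≥ 3` (the blocks of the block–cut tree, the cut
vertices as extra exits), their contractions and deletions — the open core being the triangle.
-/

namespace PercRepro

namespace ZoneZ

namespace MultiExit

open ZoneData Pendant Finset TwoExit TreeClosure

/-! ## Cone hosts -/

/-- A host `Z` with exits `u` and anchor `a` is a CONE HOST when its block map sends every family of cone members
into the cone: CONJECTURE (BLOCK MAP) for that host. -/
def ConeHost {ι V E U₁ U₂ : Type} [Fintype ι] [Fintype E] [DecidableEq E] (Z : ZoneData V E U₁ U₂)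
    (u : ι → V) (a : V) : Prop :=
  ∀ w : ι → Vec6, (∀ k, InCone (w k)) → InCone (blockMap Z u a w)

/-- A cone host sends every family of cone members into the cone. -/
theorem ConeHost.inCone {ι V E U₁ U₂ : Type} [Fintype ι] [Fintype E] [DecidableEq E] {Z : ZoneData V E U₁ U₂}
    {u : ι → V} {a : V} (h : ConeHost Z u a) (w : ι → Vec6) (hw : ∀ k, InCone (w k)) :
    InCone (blockMap Z u a w) :=
  h w hw

/-- A cone family restricted along a map of indices is a cone family. -/
theorem inCone_comp {ι ι' : Type} (w : ι → Vec6) (hw : ∀ k, InCone (w k)) (f : ι' → ι) :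
    ∀ k, InCone ((w ∘ f) k) :=
  fun k => hw (f k)

/-- The family with `X` in the extra slot and `w` elsewhere is a cone family when `X` and the `w k` are. -/
theorem inCone_wplus {ι : Type} (X : Vec6) (hX : InCone X) (w : ι → Vec6) (hw : ∀ k, InCone (w k)) :
    ∀ o, InCone (wplus X w o) := by
  intro o
  cases o with
  | none => exact hX
  | some k => exact hw k

/-! ## The built hosts -/

/-- THE BUILT HOSTS: the inductive closure of the cone hosts under the surgeries of the block map. -/
inductive Built : ∀ {ι V E U₁ U₂ : Type} [Fintype ι] [DecidableEq ι] [Fintype E] [DecidableEq E],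
    ZoneData V E U₁ U₂ → (ι → V) → V → Prop
  /-- a cone host -/
  | core {ι V E U₁ U₂ : Type} [Fintype ι] [DecidableEq ι] [Fintype E] [DecidableEq E]
      (Z : ZoneData V E U₁ U₂) (u : ι → V) (a : V) (h : ConeHost Z u a) : Built Z u a
  /-- the subdivision of an edge, from the host and its loopified form -/
  | subdiv {ι V E U₁ U₂ : Type} [Fintype ι] [DecidableEq ι] [Fintype E] [DecidableEq E]
      (Z : ZoneData V E U₁ U₂) (e₀ : E) (u : ι → V) (a : V) (h₁ : Built Z u a)
      (h₂ : Built (loopify Z e₀) u a) : Built (subdiv Z e₀) (fun k => some (u k)) (some a)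
  /-- an edge replaced by a path with `n` internal vertices, from the host and its loopified form -/
  | path {ι V E U₁ U₂ : Type} [Fintype ι] [DecidableEq ι] [Fintype E] [DecidableEq E]
      (Z : ZoneData V E U₁ U₂) (e₀ : E) (n : ℕ) (u : ι → V) (a : V) (h₁ : Built Z u a)
      (h₂ : Built (loopify Z e₀) u a) : Built (pathHost Z e₀ n) (fun k => Sum.inl (u k)) (Sum.inl a)
  /-- the loopified host, from the host with the edge deleted -/
  | loopify {ι V E U₁ U₂ : Type} [Fintype ι] [DecidableEq ι] [Fintype E] [DecidableEq E]
      (Z : ZoneData V E U₁ U₂) (e₀ : E) (u : ι → V) (a : V) (h : Built (del Z e₀) u a) :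
      Built (loopify Z e₀) u a
  /-- a loop at a vertex -/
  | addLoop {ι V E U₁ U₂ : Type} [Fintype ι] [DecidableEq ι] [Fintype E] [DecidableEq E]
      (Z : ZoneData V E U₁ U₂) (x : V) (u : ι → V) (a : V) (h : Built Z u a) : Built (addLoop Z x) u a
  /-- a pendant edge to a new vertex -/
  | addPendant {ι V E U₁ U₂ : Type} [Fintype ι] [DecidableEq ι] [Fintype E] [DecidableEq E]
      (Z : ZoneData V E U₁ U₂) (x : V) (u : ι → V) (a : V) (h : Built Z u a) :
      Built (addPendant Z x) (fun k => some (u k)) (some a)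
  /-- an edge doubled, from the host and its contraction -/
  | dup {ι V E U₁ U₂ : Type} [Fintype ι] [DecidableEq ι] [Fintype E] [DecidableEq E] [DecidableEq V]
      (Z : ZoneData V E U₁ U₂) (e₀ : E) (u : ι → V) (a : V) (h₁ : Built Z u a)
      (h₂ : Built (contract Z (Z.fst e₀) (Z.snd e₀)) (fun k => redC (Z.fst e₀) (Z.snd e₀) (u k))
        (redC (Z.fst e₀) (Z.snd e₀) a)) : Built (dup Z e₀) u a
  /-- an edge replaced by a bundle of `m + 1` parallel copies, from the host and its contraction -/
  | bundle {ι V E U₁ U₂ : Type} [Fintype ι] [DecidableEq ι] [Fintype E] [DecidableEq E] [DecidableEq V]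
      (Z : ZoneData V E U₁ U₂) (e₀ : E) (m : ℕ) (u : ι → V) (a : V) (h₁ : Built Z u a)
      (h₂ : Built (contract Z (Z.fst e₀) (Z.snd e₀)) (fun k => redC (Z.fst e₀) (Z.snd e₀) (u k))
        (redC (Z.fst e₀) (Z.snd e₀) a)) : Built (bundle Z e₀ m) u a
  /-- the wedge of two hosts at their anchors -/
  | wedge {ι₁ ι₂ V₁ E₁ U₁ W₁ V₂ E₂ U₂ W₂ : Type} [Fintype ι₁] [DecidableEq ι₁] [Fintype ι₂] [DecidableEq ι₂]
      [Fintype E₁] [DecidableEq E₁] [Fintype E₂] [DecidableEq E₂] [DecidableEq V₂]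
      (Za : ZoneData V₁ E₁ U₁ W₁) (Zb : ZoneData V₂ E₂ U₂ W₂) (u₁ : ι₁ → V₁) (u₂ : ι₂ → V₂) (a₁ : V₁)
      (a₂ : V₂) (h₁ : Built Za u₁ a₁) (h₂ : Built Zb u₂ a₂) :
      Built (wedge Za Zb a₁ a₂) (wexits a₁ a₂ u₁ u₂) (Sum.inl a₁)
  /-- a host hung at a cut vertex, from the host with the cut vertex as an extra exit and the hung host -/
  | hang {ι₁ ι₂ V₁ E₁ U₁ W₁ V₂ E₂ U₂ W₂ : Type} [Fintype ι₁] [DecidableEq ι₁] [Fintype ι₂] [DecidableEq ι₂]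
      [Fintype E₁] [DecidableEq E₁] [Fintype E₂] [DecidableEq E₂] [DecidableEq V₂]
      (Za : ZoneData V₁ E₁ U₁ W₁) (Zb : ZoneData V₂ E₂ U₂ W₂) (u₁ : ι₁ → V₁) (u₂ : ι₂ → V₂) (a₁ : V₁)
      (v : V₁) (a₂ : V₂) (h₁ : Built Za (uplus u₁ v) a₁) (h₂ : Built Zb u₂ a₂) :
      Built (wedge Za Zb v a₂) (wexits v a₂ u₁ u₂) (Sum.inl a₁)
  /-- the exits re-indexed along an equivalence -/
  | reindex {ι ι' V E U₁ U₂ : Type} [Fintype ι] [DecidableEq ι] [Fintype ι'] [DecidableEq ι'] [Fintype E]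
      [DecidableEq E] (Z : ZoneData V E U₁ U₂) (u : ι → V) (a : V) (e : ι' ≃ ι) (h : Built Z u a) :
      Built Z (u ∘ e) a
  /-- an isomorphic host -/
  | iso {ι V₁ E₁ U₁ W₁ V₂ E₂ U₂ W₂ : Type} [Fintype ι] [DecidableEq ι] [Fintype E₁] [DecidableEq E₁]
      [Fintype E₂] [DecidableEq E₂] (Z₁ : ZoneData V₁ E₁ U₁ W₁) (Z₂ : ZoneData V₂ E₂ U₂ W₂) (fv : V₁ ≃ V₂)
      (fe : E₁ ≃ E₂) (hJ : ∀ e x y, Z₂.Joins (fe e) (fv x) (fv y) ↔ Z₁.Joins e x y) (u : ι → V₁) (a : V₁)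
      (h : Built Z₁ u a) : Built Z₂ (fv ∘ u) (fv a)

/-! ## THEOREM (SURGERY CLOSURE) -/

/-- **THEOREM (SURGERY CLOSURE)**: every built host is a cone host — CONJECTURE (BLOCK MAP) is closed under
subdivision, paths, loops, pendant edges, loopification of a deleted edge, doubling, bundles, wedges, hanging,
re-indexing and isomorphism. -/
theorem coneHost_of_built {ι V E U₁ U₂ : Type} [Fintype ι] [DecidableEq ι] [Fintype E] [DecidableEq E]
    {Z : ZoneData V E U₁ U₂} {u : ι → V} {a : V} (h : Built Z u a) : ConeHost Z u a := by
  induction h with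
  | core Z u a h => exact h
  | subdiv Z e₀ u a _ _ ih₁ ih₂ =>
    intro w hw
    exact inCone_blockMap_subdiv Z e₀ u a w (ih₁ w hw) (ih₂ w hw)
  | path Z e₀ n u a _ _ ih₁ ih₂ =>
    intro w hw
    exact inCone_blockMap_path Z e₀ n u a w (ih₁ w hw) (ih₂ w hw)
  | loopify Z e₀ u a _ ih =>
    intro w hw
    rw [blockMap_loopify]
    exact (ih w hw).smul 2 (by norm_num)
  | addLoop Z x u a _ ih =>
    intro w hw
    rw [blockMap_addLoop]
    exact (ih w hw).smul 2 (by norm_num)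
  | addPendant Z x u a _ ih =>
    intro w hw
    rw [blockMap_addPendant]
    exact (ih w hw).smul 2 (by norm_num)
  | dup Z e₀ u a _ _ ih₁ ih₂ =>
    intro w hw
    exact inCone_blockMap_dup Z e₀ u a w (ih₁ w hw) (ih₂ w hw)
  | bundle Z e₀ m u a _ _ ih₁ ih₂ =>
    intro w hw
    exact inCone_blockMap_bundle Z e₀ m u a w (ih₁ w hw) (ih₂ w hw)
  | wedge Za Zb u₁ u₂ a₁ a₂ _ _ ih₁ ih₂ =>
    intro w hw
    exact inCone_blockMap_wedge Za Zb a₁ a₂ u₁ u₂ w (ih₁ _ fun k => hw (Sum.inl k))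
      (ih₂ _ fun k => hw (Sum.inr k))
  | hang Za Zb u₁ u₂ a₁ v a₂ _ _ ih₁ ih₂ =>
    intro w hw
    refine inCone_blockMap_hang Za Zb v a₂ a₁ u₁ u₂ w (fun X hX => ih₁ _ ?_) (ih₂ _ fun k => hw (Sum.inr k))
    exact inCone_wplus X hX _ fun k => hw (Sum.inl k)
  | reindex Z u a e _ ih =>
    intro w hw
    -- `w = (w ∘ e.symm) ∘ e`
    have hwe : w = (w ∘ e.symm) ∘ e := by
      funext k
      simp only [Function.comp_apply, Equiv.symm_apply_apply]
    rw [hwe, blockMap_reindex]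
    exact ih _ fun k => hw (e.symm k)
  | iso Z₁ Z₂ fv fe hJ u a _ ih =>
    intro w hw
    rw [blockMap_iso Z₁ Z₂ fv fe hJ]
    exact ih w hw

/-- A built host sends every family of cone members into the cone. -/
theorem inCone_blockMap_of_built {ι V E U₁ U₂ : Type} [Fintype ι] [DecidableEq ι] [Fintype E] [DecidableEq E]
    {Z : ZoneData V E U₁ U₂} {u : ι → V} {a : V} (h : Built Z u a) (w : ι → Vec6) (hw : ∀ k, InCone (w k)) :
    InCone (blockMap Z u a w) :=
  coneHost_of_built h w hw

end MultiExit

end ZoneZ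

end PercRepro
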